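import Summits.SmoothPoincare4.SmoothPoincare4.Theorems.CongruenceShadowsHeegaardHandlebodyCongruenceClosedStubIsProductOfPrincipalLeftFamily

/-!
# Regluing depth — crux `CongruenceShadows.HeegaardHandlebodyCongruenceClosed` (item stmt-SmoothPoincare4-14596),
line `pair-rigidity-retraction`, registered helper stub `stub_regluingDepth`

Notation: `S = S_{3+3m} = SurfaceGroup (3+3m)`, `N = (N₀,N₁,N₂) = s4Kernels.stabilizeIter m`,
`H = Stab N₀ ∩ Stab N₁`, `C = Stab N₂` (in `Aut S`); `K_M = {γ | ∀ s, γ s * s⁻¹ ∈ M}` is the level-`M`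
congruence kernel (`γ ≡ id (mod M)`); `T_θ = N₀ ⊔ N₁ ⊔ θN₂` is the normal subgroup killed by regluing the third
handlebody along `θ ∈ Aut S`, and `G_θ = S ⧸ T_θ` is the fundamental group of the reglued 4-manifold (the OPEN stub
P3 of the line asks `T_ρ = ⊤` for every product-congruent `ρ`).

* `regluing_congr_id` (general group `G`): if `ρ ≡ x ∘ c (mod M)` with `M` characteristic, then
  `γ := x⁻¹ ∘ ρ ∘ c⁻¹` (the `MulEquiv.trans` chain `(c.symm.trans ρ).trans x.symm`, `γ s = x⁻¹ (ρ (c⁻¹ s))`)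
  is `≡ id (mod M)`.
* `toMonoidHom_eq_comp_regluing`, `map_eq_map_regluing`, `sup_map_eq_map_regluing` (general group): `ρ = x ∘ γ ∘ c`
  on the nose, hence `ρK = x(γK)` whenever `cK = K`, and `A ⊔ B ⊔ ρK = x(A ⊔ B ⊔ γK)` if moreover `xA = A`,
  `xB = B`.
* `regluingDepth` — one level: from `x ∈ H`, `c ∈ C`, `ρ ≡ x ∘ c (mod M)` get `γ ∈ K_M` with `ρN₂ = x(γN₂)` and
  `T_ρ = x(T_γ)`.
* `stub_regluingDepth` — the registered signature verbatim: a product-congruent `ρ` is, at EVERY characteristic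
  finite-index level `M`, up to some `x_M ∈ H`, a regluing by some `γ_M ∈ K_M`.
* Riders: `map_equiv_eq_top_iff`, `tripleJoin_eq_top_iff_of_regluing` (`T_ρ = ⊤ ↔ T_γ = ⊤`: P3 for `ρ` is P3 for
  the arbitrarily deep regluing `γ_M`), `normal_tripleJoin`, `nonempty_gluedQuotient_equiv` (`G_γ ≃* G_ρ` via `x`,
  `QuotientGroup.congr`).
-/

noncomputable section

-- the prescribed namespace `Summit.<P>.<Sub>.…` duplicates `SmoothPoincare4` (P = Sub)
set_option linter.dupNamespace false

namespace Summit.SmoothPoincare4.SmoothPoincare4.Theorems.HeegaardHandlebodyCongruenceClosed.PairRigidityRetraction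

open Literature.Topology.FourManifolds Subgroup

/-! ## The regluing automorphism `γ = x⁻¹ ∘ ρ ∘ c⁻¹` (general group) -/

/-- If `ρ ≡ x ∘ c (mod M)` pointwise and `M` is characteristic, then `γ := x⁻¹ ∘ ρ ∘ c⁻¹`
(`= (c.symm.trans ρ).trans x.symm`, i.e. `γ s = x⁻¹ (ρ (c⁻¹ s))`) is congruent to the identity: `γ s * s⁻¹ ∈ M`.
(Evaluate the congruence at `c⁻¹ s` and divide by `x` on the left, `symm_apply_mul_inv_mem`.) [folklore] -/
theorem regluing_congr_id {G : Type*} [Group G] {ρ x c : G ≃* G} {M : Subgroup G} (hM : M.Characteristic)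
    (h : ∀ s, ρ s * (x (c s))⁻¹ ∈ M) : ∀ s, ((c.symm.trans ρ).trans x.symm) s * s⁻¹ ∈ M := fun s => by
  have h₁ : ρ (c.symm s) * (x s)⁻¹ ∈ M := by simpa using h (c.symm s)
  simpa using symm_apply_mul_inv_mem hM x h₁

/-- `ρ = x ∘ γ ∘ c` on the nose for `γ := x⁻¹ ∘ ρ ∘ c⁻¹`, as an identity of monoid homomorphisms. [folklore] -/
theorem toMonoidHom_eq_comp_regluing {G : Type*} [Group G] (ρ x c : G ≃* G) :
    ρ.toMonoidHom = x.toMonoidHom.comp (((c.symm.trans ρ).trans x.symm).toMonoidHom.comp c.toMonoidHom) := by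
  ext s
  simp

/-- Hence `ρK = x(γK)` for every subgroup `K` with `cK = K` (`γ := x⁻¹ ∘ ρ ∘ c⁻¹`). [folklore] -/
theorem map_eq_map_regluing {G : Type*} [Group G] (ρ x : G ≃* G) {c : G ≃* G} {K : Subgroup G}
    (hc : K.map c.toMonoidHom = K) :
    K.map ρ.toMonoidHom = (K.map ((c.symm.trans ρ).trans x.symm).toMonoidHom).map x.toMonoidHom := by
  rw [toMonoidHom_eq_comp_regluing ρ x c, ← Subgroup.map_map, ← Subgroup.map_map, hc]

/-- And `A ⊔ B ⊔ ρK = x(A ⊔ B ⊔ γK)` whenever moreover `xA = A` and `xB = B` (`γ := x⁻¹ ∘ ρ ∘ c⁻¹`, `cK = K`).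
[folklore] -/
theorem sup_map_eq_map_regluing {G : Type*} [Group G] (ρ : G ≃* G) {x c : G ≃* G} {A B K : Subgroup G}
    (hA : A.map x.toMonoidHom = A) (hB : B.map x.toMonoidHom = B) (hc : K.map c.toMonoidHom = K) :
    A ⊔ B ⊔ K.map ρ.toMonoidHom =
      (A ⊔ B ⊔ K.map ((c.symm.trans ρ).trans x.symm).toMonoidHom).map x.toMonoidHom := by
  rw [Subgroup.map_sup, Subgroup.map_sup, hA, hB, ← map_eq_map_regluing ρ x hc]

/-! ## Regluing depth for the standard triple -/

/-- **Regluing depth, one level.** Let `x ∈ H = Stab N₀ ∩ Stab N₁`, `c ∈ C = Stab N₂` and `ρ ≡ x ∘ c (mod M)` with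
`M` characteristic.  Then `γ := x⁻¹ ∘ ρ ∘ c⁻¹ ≡ id (mod M)`, `ρN₂ = x(γN₂)` and
`N₀ ⊔ N₁ ⊔ ρN₂ = x(N₀ ⊔ N₁ ⊔ γN₂)`: the glued handlebody of `ρ` is, up to the element `x` of `H`, the glued
handlebody of an automorphism that is trivial modulo `M`. [folklore] -/
theorem regluingDepth {m : ℕ} (ρ : SurfaceGroup (3 + 3 * m) ≃* SurfaceGroup (3 + 3 * m))
    {M : Subgroup (SurfaceGroup (3 + 3 * m))} (hM : M.Characteristic)
    (x c : SurfaceGroup (3 + 3 * m) ≃* SurfaceGroup (3 + 3 * m))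
    (hx0 : (s4Kernels.stabilizeIter m 0).map x.toMonoidHom = s4Kernels.stabilizeIter m 0)
    (hx1 : (s4Kernels.stabilizeIter m 1).map x.toMonoidHom = s4Kernels.stabilizeIter m 1)
    (hc : (s4Kernels.stabilizeIter m 2).map c.toMonoidHom = s4Kernels.stabilizeIter m 2)
    (h : ∀ s, ρ s * (x (c s))⁻¹ ∈ M) :
    ∃ γ x : SurfaceGroup (3 + 3 * m) ≃* SurfaceGroup (3 + 3 * m),
      (∀ s, γ s * s⁻¹ ∈ M) ∧
      (s4Kernels.stabilizeIter m 0).map x.toMonoidHom = s4Kernels.stabilizeIter m 0 ∧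
      (s4Kernels.stabilizeIter m 1).map x.toMonoidHom = s4Kernels.stabilizeIter m 1 ∧
      (s4Kernels.stabilizeIter m 2).map ρ.toMonoidHom =
        ((s4Kernels.stabilizeIter m 2).map γ.toMonoidHom).map x.toMonoidHom ∧
      s4Kernels.stabilizeIter m 0 ⊔ s4Kernels.stabilizeIter m 1 ⊔
          (s4Kernels.stabilizeIter m 2).map ρ.toMonoidHom =
        (s4Kernels.stabilizeIter m 0 ⊔ s4Kernels.stabilizeIter m 1 ⊔
          (s4Kernels.stabilizeIter m 2).map γ.toMonoidHom).map x.toMonoidHom :=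
  ⟨(c.symm.trans ρ).trans x.symm, x, regluing_congr_id hM h, hx0, hx1, map_eq_map_regluing ρ x hc,
    sup_map_eq_map_regluing ρ hx0 hx1 hc⟩

/-- **Registered stub `stub_regluingDepth` of line `pair-rigidity-retraction`** (signature verbatim as registered on
stmt-SmoothPoincare4-14596): a product-congruent `ρ` (`ρ ≡ x_M ∘ c_M (mod M)` with `x_M ∈ H`, `c_M ∈ C` at every
characteristic finite-index level `M`) is, at every such level and up to an element `x ∈ H`, a regluing by an
automorphism `γ ≡ id (mod M)`: `ρN₂ = x(γN₂)` and `N₀ ⊔ N₁ ⊔ ρN₂ = x(N₀ ⊔ N₁ ⊔ γN₂)`; `= regluingDepth` at the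
level `M`. [folklore] -/
theorem stub_regluingDepth : ∀ (m : ℕ) (ρ : Literature.Topology.FourManifolds.SurfaceGroup (3 + 3 * m) ≃* Literature.Topology.FourManifolds.SurfaceGroup (3 + 3 * m)), (∀ M : Subgroup (Literature.Topology.FourManifolds.SurfaceGroup (3 + 3 * m)), M.Characteristic → M.FiniteIndex → ∃ x c : Literature.Topology.FourManifolds.SurfaceGroup (3 + 3 * m) ≃* Literature.Topology.FourManifolds.SurfaceGroup (3 + 3 * m), (Literature.Topology.FourManifolds.s4Kernels.stabilizeIter m 0).map x.toMonoidHom = Literature.Topology.FourManifolds.s4Kernels.stabilizeIter m 0 ∧ (Literature.Topology.FourManifolds.s4Kernels.stabilizeIter m 1).map x.toMonoidHom = Literature.Topology.FourManifolds.s4Kernels.stabilizeIter m 1 ∧ (Literature.Topology.FourManifolds.s4Kernels.stabilizeIter m 2).map c.toMonoidHom = Literature.Topology.FourManifolds.s4Kernels.stabilizeIter m 2 ∧ ∀ s, ρ s * (x (c s))⁻¹ ∈ M) → ∀ M : Subgroup (Literature.Topology.FourManifolds.SurfaceGroup (3 + 3 * m)), M.Characteristic → M.FiniteIndex → ∃ γ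 x : Literature.Topology.FourManifolds.SurfaceGroup (3 + 3 * m) ≃* Literature.Topology.FourManifolds.SurfaceGroup (3 + 3 * m), (∀ s, γ s * s⁻¹ ∈ M) ∧ (Literature.Topology.FourManifolds.s4Kernels.stabilizeIter m 0).map x.toMonoidHom = Literature.Topology.FourManifolds.s4Kernels.stabilizeIter m 0 ∧ (Literature.Topology.FourManifolds.s4Kernels.stabilizeIter m 1).map x.toMonoidHom = Literature.Topology.FourManifolds.s4Kernels.stabilizeIter m 1 ∧ (Literature.Topology.FourManifolds.s4Kernels.stabilizeIter m 2).map ρ.toMonoidHom = ((Literature.Topology.FourManifolds.s4Kernels.stabilizeIter m 2).map γ.toMonoidHom).map x.toMonoidHom ∧ Literature.Topology.FourManifolds.s4Kernels.stabilizeIter m 0 ⊔ Literature.Topology.FourManifolds.s4Kernels.stabilizeIter m 1 ⊔ (Literature.Topology.FourManifolds.s4Kernels.stabilizeIter m 2).map ρ.toMonoidHom = (Literature.Topology.FourManifolds.s4Kernels.stabilizeIter m 0 ⊔ Literature.Topology.FourManifolds.s4Kernels.stabilizeIter m 1 ⊔ (Literature.Topology.FourManifolds.s4Kernels.stabilizeIter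 m 2).map γ.toMonoidHom).map x.toMonoidHom :=
  fun _ ρ hρ M hM hF => by
    obtain ⟨x, c, hx0, hx1, hc, h⟩ := hρ M hM hF
    exact regluingDepth ρ hM x c hx0 hx1 hc h

/-! ## Riders: the glued group of `ρ` is the glued group of the deep regluing `γ` -/

/-- An automorphism carries a subgroup onto `⊤` iff the subgroup is `⊤`. [folklore] -/
theorem map_equiv_eq_top_iff {G : Type*} [Group G] (x : G ≃* G) (K : Subgroup G) :
    K.map x.toMonoidHom = ⊤ ↔ K = ⊤ := by
  constructor
  · intro h
    have h' := congrArg (Subgroup.comap x.toMonoidHom) h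
    rwa [Subgroup.comap_map_eq_self_of_injective x.injective, Subgroup.comap_top] at h'
  · rintro rfl
    exact Subgroup.map_top_of_surjective _ x.surjective

/-- **P3 descends along regluing depth.** If `N₀ ⊔ N₁ ⊔ ρN₂ = x(N₀ ⊔ N₁ ⊔ γN₂)` (as produced by `regluingDepth`),
then the glued group of `ρ` is trivial iff the glued group of `γ` is: `T_ρ = ⊤ ↔ T_γ = ⊤`. [folklore] -/
theorem tripleJoin_eq_top_iff_of_regluing {m : ℕ}
    {ρ γ x : SurfaceGroup (3 + 3 * m) ≃* SurfaceGroup (3 + 3 * m)}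
    (h : s4Kernels.stabilizeIter m 0 ⊔ s4Kernels.stabilizeIter m 1 ⊔
          (s4Kernels.stabilizeIter m 2).map ρ.toMonoidHom =
        (s4Kernels.stabilizeIter m 0 ⊔ s4Kernels.stabilizeIter m 1 ⊔
          (s4Kernels.stabilizeIter m 2).map γ.toMonoidHom).map x.toMonoidHom) :
    s4Kernels.stabilizeIter m 0 ⊔ s4Kernels.stabilizeIter m 1 ⊔
        (s4Kernels.stabilizeIter m 2).map ρ.toMonoidHom = ⊤ ↔
      s4Kernels.stabilizeIter m 0 ⊔ s4Kernels.stabilizeIter m 1 ⊔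
        (s4Kernels.stabilizeIter m 2).map γ.toMonoidHom = ⊤ := by
  rw [h, map_equiv_eq_top_iff]

/-- The reglued relation subgroup `T_θ = N₀ ⊔ N₁ ⊔ θN₂` is normal. [folklore] -/
theorem normal_tripleJoin (m : ℕ) (θ : SurfaceGroup (3 + 3 * m) ≃* SurfaceGroup (3 + 3 * m)) :
    (s4Kernels.stabilizeIter m 0 ⊔ s4Kernels.stabilizeIter m 1 ⊔
      (s4Kernels.stabilizeIter m 2).map θ.toMonoidHom).Normal := by
  haveI h0n : (s4Kernels.stabilizeIter m 0).Normal := stabilizeIter_normal m 0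
  haveI h1n : (s4Kernels.stabilizeIter m 1).Normal := stabilizeIter_normal m 1
  haveI h2n : ((s4Kernels.stabilizeIter m 2).map θ.toMonoidHom).Normal := map_stabilizeIter_normal m 2 θ
  haveI h01n : (s4Kernels.stabilizeIter m 0 ⊔ s4Kernels.stabilizeIter m 1).Normal := Subgroup.sup_normal _ _
  exact Subgroup.sup_normal _ _

/-- **The glued groups agree.** If `N₀ ⊔ N₁ ⊔ ρN₂ = x(N₀ ⊔ N₁ ⊔ γN₂)` (as produced by `regluingDepth`), then `x`
induces `G_γ = S ⧸ T_γ ≃* S ⧸ T_ρ = G_ρ` (`QuotientGroup.congr`): the fundamental group of the 4-manifold reglued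
along the product-congruent `ρ` is that of the 4-manifold reglued along the level-`M`-trivial `γ`. [folklore] -/
theorem nonempty_gluedQuotient_equiv {m : ℕ}
    {ρ γ : SurfaceGroup (3 + 3 * m) ≃* SurfaceGroup (3 + 3 * m)}
    (x : SurfaceGroup (3 + 3 * m) ≃* SurfaceGroup (3 + 3 * m))
    (h : s4Kernels.stabilizeIter m 0 ⊔ s4Kernels.stabilizeIter m 1 ⊔
          (s4Kernels.stabilizeIter m 2).map ρ.toMonoidHom =
        (s4Kernels.stabilizeIter m 0 ⊔ s4Kernels.stabilizeIter m 1 ⊔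
          (s4Kernels.stabilizeIter m 2).map γ.toMonoidHom).map x.toMonoidHom) :
    haveI := normal_tripleJoin m γ
    haveI := normal_tripleJoin m ρ
    Nonempty
      (SurfaceGroup (3 + 3 * m) ⧸ (s4Kernels.stabilizeIter m 0 ⊔ s4Kernels.stabilizeIter m 1 ⊔
          (s4Kernels.stabilizeIter m 2).map γ.toMonoidHom) ≃*
        SurfaceGroup (3 + 3 * m) ⧸ (s4Kernels.stabilizeIter m 0 ⊔ s4Kernels.stabilizeIter m 1 ⊔
          (s4Kernels.stabilizeIter m 2).map ρ.toMonoidHom)) := by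
  haveI := normal_tripleJoin m γ
  haveI := normal_tripleJoin m ρ
  exact ⟨QuotientGroup.congr _ _ x h.symm⟩

end Summit.SmoothPoincare4.SmoothPoincare4.Theorems.HeegaardHandlebodyCongruenceClosed.PairRigidityRetraction

end
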